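import Summits.ResolutionOfSingularities.ResolutionOfSingularities.Theorems.WildQuotientsSummitReductionStubPairOrbitBlowupCentreFlatLemmas4
import Literature.AlgebraicGeometry.Resolution.AlterationsSemiStableCodimTwoBlowupExceptionalConnectedHolds
import HarnessLib

/-!
# `WildQuotients.SummitReduction` (stmt-ResolutionOfSingularities-16324), line `FramePerfect`, skeleton v8:
# stub C1 `stub_pair_orbitBlowupCentreFlat` — de Jong 1996, 3.4 Claim (ii) over the orbit centre:
# flatness of the blown-up curve and geometric connectedness of the exceptional fibres

Route `ResolutionOfSingularities/WildQuotients`, crux `SummitReduction`; registered stub C1 of the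
line skeleton `Cruxes/SummitReduction/Lines/FramePerfect.lean` (v8, lead c4). Worker file.

For a quasi-split `G`-semi-stable pair of the line (de Jong 1997, 5.7–5.11) — `Y` regular
integral projective over a field `k`, `D ⊆ Y` a `G`-strict normal crossings divisor,
`f : X ⟶ Y` an equivariant quasi-split semi-stable curve smooth over `Y ∖ D` — a codimension-2
singular point `x` and ANY blowing up `π : X₁ ⟶ X` in the reduced ideal sheaf of the orbit closure
`Z = cl(G · x)`, this file proves the two clauses of de Jong 1996, 3.4 Claim (ii) that live over
the centre: (H1) `π ≫ f` is flat at every point of `X₁` over `Z`, and (H3) the fibres of `π` over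
the geometric points of `Z` are connected ("`X' → Y` is flat", the charts of p. 64 being
`A`-flat; the exceptional fibres are the conics `{UV = c W²}`). The tree proves both for ONE
component `cl{x}` in Situation 4.23 over an algebraically closed field
(`DeJong1996.SemiStablePair.flat_stalkMap_comp_blowup_of_mem_closure`,
`DeJong1996SemiStableCodimTwoBlowupExceptionalConnected_holds`) by transfer from a formal model
`𝒪̂_{X,x₁} ≅ Λ⟦u, v⟧/(uv - c t²)` carrying the completed ideal of the centre onto `(u, v, t)`; the
transfers themselves (`flat_stalkMap_comp_of_isBlowup_of_nodeDeformationRing`,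
`connectedSpace_pullback_of_isBlowup_nodeDeformationRing`: "completion and blowing up commute")
are general. Here:

* `centreFlat_connectedSpace_pullback_of_nodeDeformationRing` — the connectedness transfer for an
  arbitrary closed centre `T` and an arbitrary (not necessarily closed) point `x₁` carrying a
  formal model (the tree's `connectedSpace_pullback_blowup_of_subset_closure` with its first step
  — the choice of the model — turned into a hypothesis);
* `stub_pair_orbitBlowupCentreFlat` — the stub: at every point `z ∈ Z` the quasi-split pair has
  such a formal model FOR THE ORBIT CLOSURE, over Cohen coordinates `Λ = κ(f z)⟦T⟧` of the base and
  with `t = ∏_{i ∈ S} Tᵢ` the product over the branches of the translates `cl{ρ(g) x}` through `z`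
  (`centreFlat_exists_nodeDeformationRing_orbitCentre_compat`, files `…CentreFlatLemmas{,2,3,4}`:
  2.23 + 3.3 at quasi-split points over any field, 3.4 ¶2 for each translate, and
  `⋂ (u, v, Tᵢ) = (u, v, ∏ Tᵢ)`); (H1) and (H3) follow by the two transfers, applied at the point
  itself. The `G`-strictness of `D`, the action on `Y` and the equivariance of `f` are not used
  by these two clauses.
-/

-- the problem path `ResolutionOfSingularities/ResolutionOfSingularities` makes the conventional
-- namespace repeat a component, which `linter.dupNamespace` flags
set_option linter.dupNamespace false

noncomputable section

open CategoryTheory CategoryTheory.Limits AlgebraicGeometry TopologicalSpace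
open Literature.AlgebraicGeometry.Resolution
open Literature.AlgebraicGeometry.Resolution.DeJong1996
open Literature.AlgebraicGeometry
open Scheme.IdealSheafData IsLocalRing NodalDeformation

namespace Summit.ResolutionOfSingularities.ResolutionOfSingularities.Theorems

/-! ## The connectedness transfer from a formal model, at any point of any closed centre -/

/-- **de Jong 1996, 3.4 Claim (ii) — the fibres of the blow-up over the centre are geometrically
connected: the transfer from a formal model.** Let `π : X' ⟶ X` be a blowing up of the locally
Noetherian `X` in the reduced ideal sheaf of a closed `T`, and `x₁ ∈ X` a point with a formal model
`e : 𝒪̂_{X,x₁} ≅ Λ⟦u, v⟧/(uv - c t²)` (`Λ` Noetherian, `t ∈ Λ⁰`) carrying `I(T)_{x₁} 𝒪̂_{X,x₁}` onto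
`(u, v, t)`. Then for every field `K` and every `K`-point of `T` specialising to `x₁`, the fibre
`X' ×_X Spec K` is connected: base change `π` along the flat `ι : Spec B̂' → Spec 𝒪_{X,x₁} → X`, a
blow-up of `Spec B̂'` in `(u, v, t)~` (GW 13.91 (2)) whose fibres over `V(u, v, t)` are connected
conics (`connectedSpace_pullback_of_isBlowup_nodeDeformationRing`: "completion and blowing up
commute"); lift the image point to `z ∈ Spec B̂'`; a common field `K'` of `κ(z)` and `K`
identifies `X' ×_X Spec K'` with such a fibre, and `Spec K' → Spec K` is surjective. (The tree's
`DeJong1996.SemiStablePair.connectedSpace_pullback_blowup_of_subset_closure`, verbatim from its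
second step on.) [cite: DeJong1996, 3.4 Claim (ii), pp. 63–64] -/
theorem centreFlat_connectedSpace_pullback_of_nodeDeformationRing {X' X : Scheme.{0}}
    [IsLocallyNoetherian X] {π : X' ⟶ X} (T : Closeds X) (hπ : IsBlowup π (vanishingIdeal T))
    {x₁ : X} {Λ : Type} [CommRing Λ] [IsNoetherianRing Λ] {c t : Λ} (ht : t ∈ nonZeroDivisors Λ)
    (e : AdicCompletion (maximalIdeal (X.presheaf.stalk x₁)) (X.presheaf.stalk x₁) ≃+*
      NodeDeformationRing Λ (c * t ^ 2))
    (hcentre : ((stalkIdeal (vanishingIdeal T) x₁).map (algebraMap (X.presheaf.stalk x₁)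
        (AdicCompletion (maximalIdeal (X.presheaf.stalk x₁)) (X.presheaf.stalk x₁)))).map
        e.toRingHom =
      (nodalCentre Λ c t).map (AlgebraicNodeRing.toNodeDeformationRing Λ (c * t ^ 2)).toRingHom)
    {K : Type} [Field K] (cK : Spec (.of K) ⟶ X) (hcK : Set.range cK.base ⊆ T)
    (hsp : ∀ p : Spec (.of K), cK.base p ⤳ x₁) :
    ConnectedSpace ↥(pullback π cK) := by
  classical
  let pt : Spec (.of K) := ⟨⊥, Ideal.isPrime_bot⟩
  have hy : cK.base pt ∈ (T : Set X) := hcK ⟨pt, rfl⟩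
  let O : CommRingCat.{0} := X.presheaf.stalk x₁
  let Ô := AdicCompletion (maximalIdeal O) O
  let N := NodeDeformationRing Λ (c * t ^ 2)
  haveI : IsNoetherianRing (MvPowerSeries (Fin 2) Λ) := isNoetherianRing_mvPowerSeries Λ (Fin 2)
  haveI : IsNoetherianRing N := inferInstanceAs (IsNoetherianRing (_ ⧸ _))
  haveI : Nontrivial N := e.injective.nontrivial
  haveI : IsLocalRing N := IsLocalRing.of_surjective' (e : Ô →+* N) e.surjective
  -- the flat local map `cmap : 𝒪_{X,x₁} → 𝒪̂ ≅ N` and the flat `ι : Spec N → X`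
  let cmap : O ⟶ CommRingCat.of N := CommRingCat.ofHom ((e : Ô →+* N).comp (algebraMap O Ô))
  have hc : cmap.hom = (e : Ô →+* N).comp (algebraMap O Ô) := rfl
  have hcflat : cmap.hom.Flat := by
    rw [hc]
    exact RingHom.Flat.comp (RingHom.flat_algebraMap_iff.mpr (AdicCompletion.flat_of_isNoetherian _))
      (RingHom.Flat.of_bijective e.bijective)
  haveI : IsLocalHom cmap.hom := by
    rw [hc]
    infer_instance
  have hcentre' : (stalkIdeal (vanishingIdeal T) x₁).map cmap.hom = (nodalCentre Λ c t).map
      (AlgebraicNodeRing.toNodeDeformationRing Λ (c * t ^ 2)).toRingHom := by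
    rw [hc, ← Ideal.map_map]
    exact hcentre
  let ι : Spec (.of N) ⟶ X := Spec.map cmap ≫ X.fromSpecStalk x₁
  haveI : Flat (Spec.map cmap) := Flat.SpecMap_iff.mpr hcflat
  haveI : Flat (X.fromSpecStalk x₁) := flat_fromSpecStalk X x₁
  haveI : Flat ι := inferInstance
  -- the base change of `π` along `ι` is a blow-up of `Spec N` in `(u, v, t)`
  have hB : IsBlowup (pullback.snd π ι) (ofIdealTop (((nodalCentre Λ c t).map
      (AlgebraicNodeRing.toNodeDeformationRing Λ (c * t ^ 2)).toRingHom).map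
      (Scheme.ΓSpecIso (.of N)).inv.hom)) := by
    have h1 := hπ.pullback_snd_of_flat ι
    rwa [show ι = Spec.map cmap ≫ X.fromSpecStalk x₁ from rfl,
      comap_SpecMap_comp_fromSpecStalk_eq_ofIdealTop, hcentre'] at h1
  -- lift the image point to `z ∈ Spec N`
  obtain ⟨z, hz⟩ : ∃ z : Spec (.of N), ι z = cK pt := by
    obtain ⟨p, hp⟩ : cK pt ∈ Set.range (X.fromSpecStalk x₁) := by
      rw [Scheme.range_fromSpecStalk]
      exact hsp pt
    letI : Algebra O N := cmap.hom.toAlgebra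
    haveI : Module.Flat O N := hcflat
    haveI : Module.FaithfullyFlat O N := Module.FaithfullyFlat.of_flat_of_isLocalHom
    obtain ⟨z, hz⟩ := PrimeSpectrum.comap_surjective_of_faithfullyFlat (A := O) (B := N) p
    refine ⟨z, ?_⟩
    change X.fromSpecStalk x₁ (Spec.map cmap z) = cK pt
    rw [← hp]
    congr 1
  -- a common field `K'` of `κ(z)` and `K`: the residue field of a point `q` of `Spec N ×_X Spec K`
  obtain ⟨q, hq, -⟩ := Scheme.Pullback.exists_preimage_pullback (f := ι) (g := cK) z pt hz
  let Q := pullback ι cK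
  let κq := Q.fromSpecResidueField q
  let sN : Spec (Q.residueField q) ⟶ Spec (.of N) := κq ≫ pullback.fst ι cK
  let sK : Spec (Q.residueField q) ⟶ Spec (.of K) := κq ≫ pullback.snd ι cK
  have hcomm : sN ≫ ι = sK ≫ cK := by
    simp only [sN, sK, Category.assoc, pullback.condition]
  -- the ring map `χ : N → K'`; its kernel contains `(u, v, t)`
  let χ : N →+* Q.residueField q := (Spec.preimage sN).hom
  have hsN : sN = Spec.map (CommRingCat.ofHom χ) := by
    rw [CommRingCat.ofHom_hom]
    exact (Spec.map_preimage sN).symm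
  let pt' : Spec (Q.residueField q) := ⟨⊥, Ideal.isPrime_bot⟩
  have hκq : κq pt' = q := Scheme.fromSpecResidueField_apply q pt'
  have hzχ : z.asIdeal = RingHom.ker χ := by
    have h1 : sN pt' = z := by
      change pullback.fst ι cK (κq pt') = z
      rw [hκq, hq]
    rw [← h1, hsN, RingHom.ker_eq_comap_bot]
    rfl
  have hχ : (nodalCentre Λ c t).map
      (AlgebraicNodeRing.toNodeDeformationRing Λ (c * t ^ 2)).toRingHom ≤ RingHom.ker χ := by
    have hmem : (Spec.map cmap ≫ X.fromSpecStalk x₁) z ∈ (T : Set X) := by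
      change ι z ∈ (T : Set X)
      rw [hz]
      exact hy
    rw [SpecMap_comp_fromSpecStalk_mem_iff, hcentre', hzχ] at hmem
    exact hmem
  -- the fibre of the blown-up formal model over `Spec K'` is connected
  haveI hconn := connectedSpace_pullback_of_isBlowup_nodeDeformationRing Λ c t ht χ hχ
    (pullback.snd π ι) hB
  -- `X' ×_X Spec K' ≅ (X' ×_X Spec N) ×_N Spec K'`
  haveI : ConnectedSpace ↥(pullback (pullback.snd π ι) sN) := by
    rw [hsN]
    exact hconn
  let e₁ := pullbackLeftPullbackSndIso π ι sN
  haveI : ConnectedSpace ↥(pullback π (sN ≫ ι)) :=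
    (Scheme.homeoOfIso e₁).surjective.connectedSpace (Scheme.homeoOfIso e₁).continuous
  haveI : ConnectedSpace ↥(pullback π (sK ≫ cK)) := by
    rw [← hcomm]
    infer_instance
  -- and `Spec K' → Spec K` is surjective
  haveI : Nonempty ↥(Spec (Q.residueField q)) := ⟨pt'⟩
  haveI : Surjective sK := inferInstance
  exact connectedSpace_pullback_of_surjective_comp π cK sK

/-! ## The stub -/

/-- **Stub C1 (`stub_pair_orbitBlowupCentreFlat`): de Jong 1996, 3.4 Claim (ii) over the orbit
centre — (H1) ∧ (H3).** For a quasi-split `G`-semi-stable pair of the line, a codimension-2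
singular point `x` and ANY blowing up `π : X₁ ⟶ X` in the reduced ideal sheaf of `Z = cl(G · x)`:
(H1) `π ≫ f` is flat at every point `x'` of `X₁` with `π x' ∈ Z` ("`X' → Y` is flat": the three
charts of the blow-up of `Spec A[u, v]/(uv - c t²)` in `(u, v, t)` are `A`-flat, p. 64), and (H3)
for every algebraically closed field `K` and every `K`-point of `Z` the fibre `X₁ ×_X Spec K` is
connected (the exceptional fibres are the conics `{UV = c W²}`). Proof: at the point `z = π x'`,
resp. the image of the `K`-point, the pair has a formal model `𝒪̂_{X,z} ≅ Λ⟦u, v⟧/(uv - c t²)` over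
the flat `𝒪_{Y,f z} → Λ = κ(f z)⟦T⟧` carrying `I(Z)_z 𝒪̂_{X,z}` onto `(u, v, t)`
(`centreFlat_exists_nodeDeformationRing_orbitCentre_compat`: 2.23 + 3.3 at quasi-split points over
any field, 3.4 ¶2 for each translate `cl{ρ(g) x} ∋ z`, `t` the product of their branches); then
"completion and blowing up commute" (`flat_stalkMap_comp_of_isBlowup_of_nodeDeformationRing`,
`centreFlat_connectedSpace_pullback_of_nodeDeformationRing`). The binders `hprojY`, `ρY`, `hDG`,
`hDstrict`, `hρf` of the registered signature are not used by these two clauses.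
[cite: DeJong1996, 3.4 Claim (ii), pp. 63–64] [cite: DeJong1997, proof of Prop. 5.11, p. 618] -/
theorem stub_pair_orbitBlowupCentreFlat (k : Type) [Field k] (Y : Scheme.{0}) [IsIntegral Y]
    (q : Y ⟶ Spec (.of k)) (_hprojY : Motives.IsProjectiveOver (Over.mk q))
    (hreg : Scheme.IsRegular Y) (D : Set Y)
    (hD : IsStrictNormalCrossingsDivisor Y D) (G : Type) [Group G] [Finite G] (ρY : G →* Aut Y)
    (_hDG : (∀ g : G, (ρY g).hom.base '' D = D))
    (_hDstrict : (∀ (g : G) (C : Set Y), Maximal (fun C : Set Y => IsIrreducible C ∧ C ⊆ D) C →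
        (C ∩ (ρY g).hom.base '' C).Nonempty → (ρY g).hom.base '' C = C))
    (X : Scheme.{0}) [IsIntegral X] (f : X ⟶ Y) (ρX : G →* Aut X)
    (hprojX : Motives.IsProjectiveOver (Over.mk (f ≫ q)))
    (_hρf : ∀ g : G, (ρX g).hom ≫ f = f ≫ (ρY g).hom) (hss : IsSemiStableCurve f)
    (hqs : (∀ x : X, (¬ ∃ U : X.Opens, x ∈ U ∧ Smooth (U.ι ≫ f)) →
        ∃ e : AdicCompletion
            ((IsLocalRing.maximalIdeal (X.presheaf.stalk x)).map (Ideal.Quotient.mk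
              ((IsLocalRing.maximalIdeal (Y.presheaf.stalk (f.base x))).map (f.stalkMap x).hom)))
            (X.presheaf.stalk x ⧸
              (IsLocalRing.maximalIdeal (Y.presheaf.stalk (f.base x))).map (f.stalkMap x).hom) ≃+*
          MvPowerSeries (Fin 2) (Y.presheaf.stalk (f.base x) ⧸ IsLocalRing.maximalIdeal (Y.presheaf.stalk (f.base x))) ⧸
            Ideal.span {(MvPowerSeries.X 0 * MvPowerSeries.X 1 :
              MvPowerSeries (Fin 2) (Y.presheaf.stalk (f.base x) ⧸ IsLocalRing.maximalIdeal (Y.presheaf.stalk (f.base x))))},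
          e.toRingHom.comp ((algebraMap (X.presheaf.stalk x ⧸
              (IsLocalRing.maximalIdeal (Y.presheaf.stalk (f.base x))).map (f.stalkMap x).hom) _).comp
            (Ideal.quotientMap ((IsLocalRing.maximalIdeal (Y.presheaf.stalk (f.base x))).map (f.stalkMap x).hom)
              (f.stalkMap x).hom Ideal.le_comap_map)) =
          algebraMap (Y.presheaf.stalk (f.base x) ⧸ IsLocalRing.maximalIdeal (Y.presheaf.stalk (f.base x))) _))
    (hsm : Smooth (f ∣_ ⟨Dᶜ, hD.isClosed.isOpen_compl⟩))
    (x : X) (hx : x ∈ Scheme.singularLocusCodimLE X 2) (X₁ : Scheme.{0}) (π : X₁ ⟶ X)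
    (hπ : IsBlowup π (Scheme.IdealSheafData.vanishingIdeal
      ⟨closure (Set.range fun g : G => (ρX g).hom.base x), isClosed_closure⟩)) :
    (∀ x' : X₁, π.base x' ∈ closure (Set.range fun g : G => (ρX g).hom.base x) →
      ((π ≫ f).stalkMap x').hom.Flat) ∧
    (∀ (K : Type) [Field K] [IsAlgClosed K] (c : Spec (.of K) ⟶ X),
      Set.range c.base ⊆ closure (Set.range fun g : G => (ρX g).hom.base x) →
        ConnectedSpace ↥(pullback π c)) := by
  haveI : IsNoetherian X := DeJong1996.isNoetherian_of_isProjectiveOver (f ≫ q) hprojX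
  haveI : IsLocallyNoetherian Y := isLocallyNoetherian_base hss
  haveI : IsProper (f ≫ q) := Motives.IsProjectiveOver.isProper (X := Over.mk (f ≫ q)) hprojX
  refine ⟨fun x' hx' => ?_, fun K _ _ cK hcK => ?_⟩
  · -- (H1): the formal model at `π x'` itself
    obtain ⟨m, c, t, ht0, e, β, hβ, hcompat, hcentre⟩ :=
      centreFlat_exists_nodeDeformationRing_orbitCentre_compat q hreg hD f hss hqs hsm ρX hx hx'
    haveI : IsNoetherianRing (MvPowerSeries (Fin m)
        (ResidueField (Y.presheaf.stalk (f.base (π.base x'))))) :=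
      isNoetherianRing_mvPowerSeries _ (Fin m)
    haveI : IsDomain (MvPowerSeries (Fin m)
        (ResidueField (Y.presheaf.stalk (f.base (π.base x'))))) :=
      NoZeroDivisors.to_isDomain _
    exact flat_stalkMap_comp_of_isBlowup_of_nodeDeformationRing π f hπ
      (mem_nonZeroDivisors_of_ne_zero ht0) e hcentre β hβ hcompat specializes_rfl
  · -- (H3): the formal model at the image of the `K`-point
    let pt : Spec (.of K) := ⟨⊥, Ideal.isPrime_bot⟩
    have hpt : ∀ p : Spec (.of K), p = pt := fun p => Subsingleton.elim p pt
    obtain ⟨m, c, t, ht0, e, β, -, -, hcentre⟩ :=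
      centreFlat_exists_nodeDeformationRing_orbitCentre_compat q hreg hD f hss hqs hsm ρX hx
        (hcK ⟨pt, rfl⟩)
    haveI : IsNoetherianRing (MvPowerSeries (Fin m)
        (ResidueField (Y.presheaf.stalk (f.base (cK.base pt))))) :=
      isNoetherianRing_mvPowerSeries _ (Fin m)
    haveI : IsDomain (MvPowerSeries (Fin m)
        (ResidueField (Y.presheaf.stalk (f.base (cK.base pt))))) :=
      NoZeroDivisors.to_isDomain _
    exact centreFlat_connectedSpace_pullback_of_nodeDeformationRing
      ⟨closure (Set.range fun g : G => (ρX g).hom.base x), isClosed_closure⟩ hπ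
      (mem_nonZeroDivisors_of_ne_zero ht0) e hcentre cK hcK (fun p => by rw [hpt p])

end Summit.ResolutionOfSingularities.ResolutionOfSingularities.Theorems

end
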